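import Literature.AlgebraicGeometry.ShimuraVarieties.UnitaryAuxiliarySplitLattice
import Literature.AlgebraicGeometry.ShimuraVarieties.UnitaryAuxiliaryLevelContainment
import HarnessLib

/-!
# The auxiliary level is a PRODUCT: `K̃_β(N) = K_V(N) × L_V(N)` for a frame adapted to a split lattice

Deligne's auxiliary construction [cite: Deligne1979ShimuraVarieties, Prop. 2.3.10 (PDF p. 32)],
[cite: Deligne1971TravauxShimura, Prop. 1.15 p. 132]: given compact subgroups `K ≤ U(H)(𝔸_f)`, `L₀ ≤ T₀(M)(𝔸_f)`,
take the split lattice `Λ = Λ₀ ⊕ Λ₀·Λ′_V ⊂ W₀ ⊕ V_M` of ★ `exists_split_lattice` (bases `Γ₀`, `Γ`) and an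
integral symplectic frame `β` of a positive multiple `n • ψ` of the auxiliary form adapted to a `ℤ`-basis of
`Λ` (★ `exists_symplecticFrame_integral`, Frobenius).  In this frame the carrier reads
`ũ_β(k, t) = T · diag(Γ₀ · res(t′) · Γ₀⁻¹, Γ · res(t′ X′) · Γ⁻¹) · T′` with `T, T′` inverse INTEGER matrices, so
`(k, t) ∈ K̃_β(N)` iff both diagonal blocks (and those of the inverse) are `≡ 1 (mod N)`; hence

* `K × L₀ ≤ K̃_β(1)` (stability of `Λ`), and
* **`K̃_β(N) = K_V(N) ×ˢ L_V(N)` for EVERY `N`** with `K_V(N) = {k | (k,1) ∈ K̃_β(N)}`, `L_V(N) = {t | (1,t) ∈ K̃_β(N)}`: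
  if `(k, t) ∈ K̃_β(N)` then the `W₀`-block says `t ≡ 1 (mod N)` on `Λ̂₀`, which transfers to the `V`-block of
  `(1, t)` (★ `exists_split_lattice` (ii)), so `(1, t) ∈ K̃_β(N)` and `(k, 1) = (k, t)(1, t)⁻¹ ∈ K̃_β(N)`.

Main statement: `exists_symplecticFrame_auxLevel_eq_prod`.  Topic `AlgebraicGeometry/ShimuraVarieties`; namespace
`Literature.AlgebraicGeometry.ShimuraVarieties.UnitaryCanonicalModel.Aux`.  Theorems only.
-/

set_option autoImplicit false

noncomputable section

open Matrix NumberField IsDedekindDomain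
open scoped TensorProduct NumberField.AdeleRing

namespace Literature.AlgebraicGeometry.ShimuraVarieties.UnitaryCanonicalModel.Aux

open Literature.AlgebraicGeometry.ModuliOfAbelianVarieties Literature.LinearAlgebra.FreeModule
open Literature.NumberTheory.Automorphic Literature.NumberTheory.Automorphic.UnitaryGroup

/-! ### §1. Generic bookkeeping -/

section Generic

/-- `(A B)_𝔸 = A_𝔸 B_𝔸` for integer matrices read in `𝔸_{ℚ,f}`. [folklore] -/
private theorem intCast_map_mul {l m n : Type} [Fintype m] (A : Matrix l m ℤ) (B : Matrix m n ℤ) :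
    (A * B).map (Int.cast : ℤ → finAdeleQ) = A.map (Int.cast : ℤ → finAdeleQ) * B.map (Int.cast : ℤ → finAdeleQ) := by
  ext i k
  simp only [Matrix.map_apply, Matrix.mul_apply, Int.cast_sum, Int.cast_mul]

/-- **Rectangular integer change of frame preserves `≡ 1 (mod N)`**: for integer matrices `P : n × n′`,
`Q : n′ × n` with `P Q = 1` and an adelic `A ≡ 1 (mod N)`, `P A Q ≡ 1 (mod N)` (`P A Q − 1 = P (A − 1) Q`).
[cite: Deligne1971TravauxShimura, Exemple 4.16 p. 150] -/
theorem IsCongOne.intConjRect {n n' : Type} [Fintype n] [DecidableEq n] [Fintype n'] [DecidableEq n'] {N : ℕ}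
    {A : Matrix n' n' finAdeleQ} (hA : IsCongOne N A) (P : Matrix n n' ℤ) (Q : Matrix n' n ℤ) (hPQ : P * Q = 1) :
    IsCongOne N (P.map (Int.cast : ℤ → finAdeleQ) * A * Q.map (Int.cast : ℤ → finAdeleQ)) := by
  have hPQA : P.map (Int.cast : ℤ → finAdeleQ) * Q.map (Int.cast : ℤ → finAdeleQ) = 1 := by
    rw [← intCast_map_mul, hPQ, Matrix.map_one Int.cast Int.cast_zero Int.cast_one]
  intro i k
  have h : P.map (Int.cast : ℤ → finAdeleQ) * A * Q.map (Int.cast : ℤ → finAdeleQ) - 1 =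
      P.map (Int.cast : ℤ → finAdeleQ) * (A - 1) * Q.map (Int.cast : ℤ → finAdeleQ) := by
    rw [Matrix.mul_sub, Matrix.sub_mul, Matrix.mul_one, hPQA]
  rw [h, Matrix.mul_apply]
  refine AddSubgroup.sum_mem _ fun b _ => ?_
  rw [Matrix.mul_apply, Finset.sum_mul]
  refine AddSubgroup.sum_mem _ fun a _ => ?_
  rw [Matrix.map_apply, Matrix.map_apply, mul_comm, ← mul_assoc]
  exact mul_mem_levelIdeal_of_mem_integralAdeles (mul_mem (intCast_mem _ _) (intCast_mem _ _)) (hA a b)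

/-- `IsCongOne` is INVARIANT under a rectangular integer change of frame `(P, Q)`, `P Q = 1`, `Q P = 1`.
[cite: Deligne1971TravauxShimura, Exemple 4.16 p. 150] -/
theorem isCongOne_intConjRect_iff {n n' : Type} [Fintype n] [DecidableEq n] [Fintype n'] [DecidableEq n'] {N : ℕ}
    (A : Matrix n' n' finAdeleQ) (P : Matrix n n' ℤ) (Q : Matrix n' n ℤ) (hPQ : P * Q = 1) (hQP : Q * P = 1) :
    IsCongOne N (P.map (Int.cast : ℤ → finAdeleQ) * A * Q.map (Int.cast : ℤ → finAdeleQ)) ↔ IsCongOne N A := by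
  refine ⟨fun h => ?_, fun h => IsCongOne.intConjRect h P Q hPQ⟩
  have hQPA : Q.map (Int.cast : ℤ → finAdeleQ) * P.map (Int.cast : ℤ → finAdeleQ) = 1 := by
    rw [← intCast_map_mul, hQP, Matrix.map_one Int.cast Int.cast_zero Int.cast_one]
  have h' := IsCongOne.intConjRect h Q P hQP
  have hA : Q.map (Int.cast : ℤ → finAdeleQ) * (P.map (Int.cast : ℤ → finAdeleQ) * A * Q.map (Int.cast : ℤ → finAdeleQ)) *
      P.map (Int.cast : ℤ → finAdeleQ) = A := by
    calc Q.map (Int.cast : ℤ → finAdeleQ) * (P.map (Int.cast : ℤ → finAdeleQ) * A * Q.map (Int.cast : ℤ → finAdeleQ)) *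
          P.map (Int.cast : ℤ → finAdeleQ)
        = (Q.map (Int.cast : ℤ → finAdeleQ) * P.map (Int.cast : ℤ → finAdeleQ)) * A *
          (Q.map (Int.cast : ℤ → finAdeleQ) * P.map (Int.cast : ℤ → finAdeleQ)) := by simp only [Matrix.mul_assoc]
      _ = A := by rw [hQPA, Matrix.one_mul, Matrix.mul_one]
  rwa [hA] at h'

/-- `diag(A, D) ≡ 1 (mod N)` iff `A ≡ 1` and `D ≡ 1 (mod N)`. [cite: Deligne1971TravauxShimura, Exemple 4.16 p. 150] -/
theorem isCongOne_fromBlocks_iff {m o : Type} [Fintype m] [DecidableEq m] [Fintype o] [DecidableEq o] {N : ℕ}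
    (A : Matrix m m finAdeleQ) (D : Matrix o o finAdeleQ) :
    IsCongOne N (Matrix.fromBlocks A 0 0 D) ↔ IsCongOne N A ∧ IsCongOne N D := by
  have h1 : Matrix.fromBlocks A 0 0 D - 1 = Matrix.fromBlocks (A - 1) 0 0 (D - 1) := by
    ext i k
    rcases i with i | i <;> rcases k with k | k <;> simp [Matrix.one_apply]
  constructor
  · intro h
    refine ⟨fun i k => ?_, fun i k => ?_⟩
    · have := h (Sum.inl i) (Sum.inl k)
      rwa [h1, Matrix.fromBlocks_apply₁₁] at this
    · have := h (Sum.inr i) (Sum.inr k)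
      rwa [h1, Matrix.fromBlocks_apply₂₂] at this
  · rintro ⟨hA, hD⟩ i k
    rw [h1]
    rcases i with i | i <;> rcases k with k | k
    · rw [Matrix.fromBlocks_apply₁₁]; exact hA i k
    · rw [Matrix.fromBlocks_apply₁₂, Matrix.zero_apply]; exact zero_mem _
    · rw [Matrix.fromBlocks_apply₂₁, Matrix.zero_apply]; exact zero_mem _
    · rw [Matrix.fromBlocks_apply₂₂]; exact hD i k

/-- A subgroup of a product containing `(1, b)` with every `(a, b)` is the product of its slices.
[cite: Deligne1971TravauxShimura, Prop. 1.15 p. 132] -/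
theorem subgroup_eq_prod_comap_of_one_mk_mem {A B : Type} [Group A] [Group B] (S : Subgroup (A × B))
    (h : ∀ a b, (a, b) ∈ S → ((1 : A), b) ∈ S) :
    S = (S.comap (MonoidHom.inl A B)).prod (S.comap (MonoidHom.inr A B)) := by
  ext ⟨a, b⟩
  rw [Subgroup.mem_prod, Subgroup.mem_comap, Subgroup.mem_comap, MonoidHom.inl_apply, MonoidHom.inr_apply]
  constructor
  · intro hab
    have h1b := h a b hab
    refine ⟨?_, h1b⟩
    have := S.mul_mem hab (S.inv_mem h1b)
    rwa [Prod.inv_mk, inv_one, Prod.mk_mul_mk, mul_one, mul_inv_cancel] at this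
  · rintro ⟨ha, hb⟩
    have := S.mul_mem ha hb
    rwa [Prod.mk_mul_mk, one_mul, mul_one] at this

/-- Products of block-diagonal matrices. [folklore] -/
private theorem fromBlocks_diag_mul_diag {m o : Type} [Fintype m] [Fintype o] {R : Type} [CommRing R]
    (A A' : Matrix m m R) (D D' : Matrix o o R) :
    Matrix.fromBlocks A 0 0 D * Matrix.fromBlocks A' 0 0 D' = Matrix.fromBlocks (A * A') 0 0 (D * D') := by
  rw [Matrix.fromBlocks_multiply]
  simp

end Generic

/-! ### §2. The frame adapted to the split lattice and the product decomposition -/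

variable {L : Type} [Field L] [NumberField L] [IsCMField L] {M : Type} [Field M] [NumberField M]
  [IsCMField M] (j : L →+* M) (H : Matrix (Fin 3) (Fin 3) L) (ξ₀ ξ : M)

/-- **Deligne's auxiliary level is a product.**  For `H` hermitian anisotropic, `ξ₀, ξ` nonzero purely imaginary
and compact subgroups `K ≤ U(H)(𝔸_f)`, `L₀ ≤ T₀(M)(𝔸_f)`, there are `n > 0`, `g > 0`, a polarization type `δ`
and a symplectic frame `F` of type `δ` for `auxForm M j H (n•ξ₀) (n•ξ)` (adapted to the split lattice of
★ `exists_split_lattice`) with `K × L₀ ≤ auxLevel F 1` and, for every `N`,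
`auxLevel F N = {k | (k,1) ∈ auxLevel F N} ×ˢ {t | (1,t) ∈ auxLevel F N}`.
[cite: Deligne1971TravauxShimura, Prop. 1.15 p. 132] [cite: Deligne1979ShimuraVarieties, Prop. 2.3.10 (PDF p. 32)] -/
theorem exists_symplecticFrame_auxLevel_eq_prod (hH : Hᴴ = H) (hξ₀ : ξ₀ ≠ 0) (hξ : ξ ≠ 0)
    (hξ₀c : IsCMField.complexConj M ξ₀ = -ξ₀) (hξc : IsCMField.complexConj M ξ = -ξ)
    (hH0 : ∀ v : Fin 3 → L, hermForm (cmConjRingHom L) H v v = 0 → v = 0)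
    (K : Subgroup ↥(finAdelic (↥(maximalRealSubfield L)) L (IsCMField.complexConj L) 3 H))
    (L₀ : Subgroup ↥(torusFinAdelic M))
    (hK : IsCompact (K : Set ↥(finAdelic (↥(maximalRealSubfield L)) L (IsCMField.complexConj L) 3 H)))
    (hL₀ : IsCompact (L₀ : Set ↥(torusFinAdelic M))) :
    ∃ (n g : ℕ) (δ : Fin g → ℕ) (F : SymplecticFrame M j H ((n : ℚ) • ξ₀) ((n : ℚ) • ξ) g δ),
      0 < n ∧ 0 < g ∧ IsPolarizationType δ ∧ K.prod L₀ ≤ auxLevel F 1 ∧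
      ∀ N : ℕ, auxLevel F N =
        ((auxLevel F N).comap (MonoidHom.inl _ _)).prod ((auxLevel F N).comap (MonoidHom.inr _ _)) := by
  classical
  -- the split lattice
  obtain ⟨Γ₀, Γ, hW, hV, htr⟩ := exists_split_lattice M j H K L₀ hK hL₀
  -- index bookkeeping: `I = (1 ⊕ 3) × d ≃ (1 × d) ⊕ (3 × d)`
  set eI : (Fin 1 ⊕ Fin 3) × Fin (Module.finrank ℚ M) ≃
      (Fin 1 × Fin (Module.finrank ℚ M)) ⊕ (Fin 3 × Fin (Module.finrank ℚ M)) :=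
    Equiv.sumProdDistrib (Fin 1) (Fin 3) (Fin (Module.finrank ℚ M)) with heI
  -- the rectangular change of coordinates `γ : I → (1×d) ⊕ (3×d)` built from `Γ₀ ⊕ Γ`
  obtain ⟨γN, hγN⟩ : ∃ γN : Matrix ((Fin 1 × Fin (Module.finrank ℚ M)) ⊕ (Fin 3 × Fin (Module.finrank ℚ M)))
      ((Fin 1 ⊕ Fin 3) × Fin (Module.finrank ℚ M)) ℚ,
      γN = (Matrix.fromBlocks (Γ₀ : Matrix (Fin 1 × Fin (Module.finrank ℚ M)) (Fin 1 × Fin (Module.finrank ℚ M)) ℚ)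
        0 0 (Γ : Matrix (Fin 3 × Fin (Module.finrank ℚ M)) (Fin 3 × Fin (Module.finrank ℚ M)) ℚ)).submatrix id eI :=
    ⟨_, rfl⟩
  obtain ⟨γN', hγN'⟩ : ∃ γN' : Matrix ((Fin 1 ⊕ Fin 3) × Fin (Module.finrank ℚ M))
      ((Fin 1 × Fin (Module.finrank ℚ M)) ⊕ (Fin 3 × Fin (Module.finrank ℚ M))) ℚ,
      γN' = (Matrix.fromBlocks ((Γ₀⁻¹ : GL (Fin 1 × Fin (Module.finrank ℚ M)) ℚ) :
          Matrix (Fin 1 × Fin (Module.finrank ℚ M)) (Fin 1 × Fin (Module.finrank ℚ M)) ℚ)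
        0 0 ((Γ⁻¹ : GL (Fin 3 × Fin (Module.finrank ℚ M)) ℚ) :
          Matrix (Fin 3 × Fin (Module.finrank ℚ M)) (Fin 3 × Fin (Module.finrank ℚ M)) ℚ)).submatrix eI id :=
    ⟨_, rfl⟩
  have hΓ₀Γ₀' : (Γ₀ : Matrix (Fin 1 × Fin (Module.finrank ℚ M)) (Fin 1 × Fin (Module.finrank ℚ M)) ℚ) *
      ((Γ₀⁻¹ : GL (Fin 1 × Fin (Module.finrank ℚ M)) ℚ) : Matrix _ _ ℚ) = 1 := by
    rw [← Units.val_mul, mul_inv_cancel, Units.val_one]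
  have hΓ₀'Γ₀ : ((Γ₀⁻¹ : GL (Fin 1 × Fin (Module.finrank ℚ M)) ℚ) : Matrix _ _ ℚ) *
      (Γ₀ : Matrix (Fin 1 × Fin (Module.finrank ℚ M)) (Fin 1 × Fin (Module.finrank ℚ M)) ℚ) = 1 := by
    rw [← Units.val_mul, inv_mul_cancel, Units.val_one]
  have hΓΓ' : (Γ : Matrix (Fin 3 × Fin (Module.finrank ℚ M)) (Fin 3 × Fin (Module.finrank ℚ M)) ℚ) *
      ((Γ⁻¹ : GL (Fin 3 × Fin (Module.finrank ℚ M)) ℚ) : Matrix _ _ ℚ) = 1 := by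
    rw [← Units.val_mul, mul_inv_cancel, Units.val_one]
  have hΓ'Γ : ((Γ⁻¹ : GL (Fin 3 × Fin (Module.finrank ℚ M)) ℚ) : Matrix _ _ ℚ) *
      (Γ : Matrix (Fin 3 × Fin (Module.finrank ℚ M)) (Fin 3 × Fin (Module.finrank ℚ M)) ℚ) = 1 := by
    rw [← Units.val_mul, inv_mul_cancel, Units.val_one]
  have hγγ' : γN * γN' = 1 := by
    rw [hγN, hγN', ← Matrix.submatrix_mul _ _ _ _ _ eI.bijective, Matrix.submatrix_id_id, fromBlocks_diag_mul_diag,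
      hΓ₀Γ₀', hΓΓ', Matrix.fromBlocks_one]
  have hγ'γ : γN' * γN = 1 := by
    rw [hγN, hγN', ← Matrix.submatrix_mul _ _ _ _ _ Function.bijective_id, fromBlocks_diag_mul_diag, hΓ₀'Γ₀, hΓ'Γ,
      Matrix.fromBlocks_one, Matrix.submatrix_one_equiv]
  -- the adapted rational basis `c` of `U = M^{1 ⊕ 3}`: `c⁎ = γ ∘ e⁎`
  set e : Module.Basis ((Fin 1 ⊕ Fin 3) × Fin (Module.finrank ℚ M)) ℚ ((Fin 1 ⊕ Fin 3) → M) :=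
    resBasis (m := Fin 1 ⊕ Fin 3) (ratBasis M) with he
  let θγ : (((Fin 1 ⊕ Fin 3) × Fin (Module.finrank ℚ M)) → ℚ) ≃ₗ[ℚ]
      (((Fin 1 × Fin (Module.finrank ℚ M)) ⊕ (Fin 3 × Fin (Module.finrank ℚ M))) → ℚ) :=
    LinearEquiv.ofLinear (Matrix.toLin' γN) (Matrix.toLin' γN')
      (by rw [← Matrix.toLin'_mul, hγγ', Matrix.toLin'_one])
      (by rw [← Matrix.toLin'_mul, hγ'γ, Matrix.toLin'_one])
  let c : Module.Basis ((Fin 1 × Fin (Module.finrank ℚ M)) ⊕ (Fin 3 × Fin (Module.finrank ℚ M))) ℚ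
      ((Fin 1 ⊕ Fin 3) → M) :=
    Module.Basis.ofEquivFun (e.equivFun.trans θγ)
  have hc : ∀ u, c.equivFun u = γN *ᵥ e.equivFun u := fun u => by
    rw [Module.Basis.equivFun_ofEquivFun]
    exact Matrix.toLin'_apply γN _
  -- the integral frame adapted to `c`
  obtain ⟨n, g, δ, F, T, T', hn, hg, hδ, hTT', hT'T, -, hβ⟩ :=
    exists_symplecticFrame_integral j H ξ₀ ξ c hH hξ₀ hξ hξ₀c hξc hH0
  refine ⟨n, g, δ, F, hn, hg, hδ, ?_⟩
  -- frame matrices: `P = T γ`, `Q = γ′ T′`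
  set Tq : Matrix (Fin g ⊕ Fin g) ((Fin 1 × Fin (Module.finrank ℚ M)) ⊕ (Fin 3 × Fin (Module.finrank ℚ M))) ℚ :=
    T.map (Int.cast : ℤ → ℚ) with hTq
  set T'q : Matrix ((Fin 1 × Fin (Module.finrank ℚ M)) ⊕ (Fin 3 × Fin (Module.finrank ℚ M))) (Fin g ⊕ Fin g) ℚ :=
    T'.map (Int.cast : ℤ → ℚ) with hT'q
  have hT'Tq : T'q * Tq = 1 := by
    rw [hTq, hT'q, ← map_intCast_mul, hT'T, Matrix.map_one Int.cast Int.cast_zero Int.cast_one]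
  have hes : ∀ ik, e.equivFun (e ik) = Pi.single ik 1 := fun ik => by
    rw [Module.Basis.equivFun_apply, e.repr_self, Finsupp.single_eq_pi_single]
  have hP : frameP F = Tq * γN := by
    ext a ik
    rw [frameP, LinearMap.toMatrix_apply, Pi.basisFun_repr, LinearEquiv.coe_coe, ← he, hβ, hc,
      hes, Matrix.mulVec_mulVec, Matrix.mulVec_single_one, Matrix.col_apply]
  have hQ : frameQ F = γN' * T'q := by
    have h1 : (γN' * T'q) * frameP F = 1 := by
      rw [hP, Matrix.mul_assoc, ← Matrix.mul_assoc T'q, hT'Tq, Matrix.one_mul, hγ'γ]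
    calc frameQ F = (γN' * T'q) * frameP F * frameQ F := by rw [h1, Matrix.one_mul]
      _ = γN' * T'q := by rw [Matrix.mul_assoc, frameP_mul_frameQ, Matrix.mul_one]
  -- over `𝔸_{ℚ,f}`
  set ι𝔸 : ℚ →+* finAdeleQ := algebraMap ℚ finAdeleQ with hι
  have hPA : framePR finAdeleQ F = T.map (Int.cast : ℤ → finAdeleQ) * γN.map ι𝔸 := by
    rw [framePR, hP, ← hι, Matrix.map_mul, hTq, Matrix.map_map]
    congr 1
    ext a ik
    simp only [Matrix.map_apply, Function.comp_apply, map_intCast]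
  have hQA : frameQR finAdeleQ F = γN'.map ι𝔸 * T'.map (Int.cast : ℤ → finAdeleQ) := by
    rw [frameQR, hQ, ← hι, Matrix.map_mul, hT'q, Matrix.map_map]
    congr 1
    ext ik a
    simp only [Matrix.map_apply, Function.comp_apply, map_intCast]
  -- the block form of the framed carrier: `γ_𝔸 · auxResFin p · γ′_𝔸 = diag(Γ₀ W Γ₀⁻¹, Γ V Γ⁻¹)`
  have hZ : ∀ p : ↥(finAdelic (↥(maximalRealSubfield L)) L (IsCMField.complexConj L) 3 H) × ↥(torusFinAdelic M),
      γN.map ι𝔸 * ((auxResFin M j H p : GL ((Fin 1 ⊕ Fin 3) × Fin (Module.finrank ℚ M)) finAdeleQ) :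
        Matrix ((Fin 1 ⊕ Fin 3) × Fin (Module.finrank ℚ M)) ((Fin 1 ⊕ Fin 3) × Fin (Module.finrank ℚ M)) finAdeleQ) *
        γN'.map ι𝔸 =
      Matrix.fromBlocks
        ((Γ₀ : Matrix (Fin 1 × Fin (Module.finrank ℚ M)) (Fin 1 × Fin (Module.finrank ℚ M)) ℚ).map ι𝔸 *
          ((auxResW₀ M p.2 : GL (Fin 1 × Fin (Module.finrank ℚ M)) finAdeleQ) :
            Matrix (Fin 1 × Fin (Module.finrank ℚ M)) (Fin 1 × Fin (Module.finrank ℚ M)) finAdeleQ) *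
          ((Γ₀⁻¹ : GL (Fin 1 × Fin (Module.finrank ℚ M)) ℚ) :
            Matrix (Fin 1 × Fin (Module.finrank ℚ M)) (Fin 1 × Fin (Module.finrank ℚ M)) ℚ).map ι𝔸)
        0 0
        ((Γ : Matrix (Fin 3 × Fin (Module.finrank ℚ M)) (Fin 3 × Fin (Module.finrank ℚ M)) ℚ).map ι𝔸 *
          ((auxResV M j H p : GL (Fin 3 × Fin (Module.finrank ℚ M)) finAdeleQ) :
            Matrix (Fin 3 × Fin (Module.finrank ℚ M)) (Fin 3 × Fin (Module.finrank ℚ M)) finAdeleQ) *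
          ((Γ⁻¹ : GL (Fin 3 × Fin (Module.finrank ℚ M)) ℚ) :
            Matrix (Fin 3 × Fin (Module.finrank ℚ M)) (Fin 3 × Fin (Module.finrank ℚ M)) ℚ).map ι𝔸) := by
    intro p
    have hX : ((auxResFin M j H p : GL ((Fin 1 ⊕ Fin 3) × Fin (Module.finrank ℚ M)) finAdeleQ) :
        Matrix ((Fin 1 ⊕ Fin 3) × Fin (Module.finrank ℚ M)) ((Fin 1 ⊕ Fin 3) × Fin (Module.finrank ℚ M)) finAdeleQ) =
        (Matrix.fromBlocks
          ((auxResW₀ M p.2 : GL (Fin 1 × Fin (Module.finrank ℚ M)) finAdeleQ) :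
            Matrix (Fin 1 × Fin (Module.finrank ℚ M)) (Fin 1 × Fin (Module.finrank ℚ M)) finAdeleQ)
          0 0
          ((auxResV M j H p : GL (Fin 3 × Fin (Module.finrank ℚ M)) finAdeleQ) :
            Matrix (Fin 3 × Fin (Module.finrank ℚ M)) (Fin 3 × Fin (Module.finrank ℚ M)) finAdeleQ)).submatrix eI eI := by
      rw [← reindex_auxResFin M j H p, ← heI, Matrix.reindex_apply, Matrix.submatrix_submatrix, Equiv.symm_comp_self,
        Matrix.submatrix_id_id]
    have h1 : γN.map ι𝔸 = (Matrix.fromBlocks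
        ((Γ₀ : Matrix (Fin 1 × Fin (Module.finrank ℚ M)) (Fin 1 × Fin (Module.finrank ℚ M)) ℚ).map ι𝔸) 0 0
        ((Γ : Matrix (Fin 3 × Fin (Module.finrank ℚ M)) (Fin 3 × Fin (Module.finrank ℚ M)) ℚ).map ι𝔸)).submatrix id eI := by
      rw [hγN, ← Matrix.submatrix_map, Matrix.fromBlocks_map, Matrix.map_zero ι𝔸 (map_zero ι𝔸),
        Matrix.map_zero ι𝔸 (map_zero ι𝔸)]
    have h2 : γN'.map ι𝔸 = (Matrix.fromBlocks
        (((Γ₀⁻¹ : GL (Fin 1 × Fin (Module.finrank ℚ M)) ℚ) :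
          Matrix (Fin 1 × Fin (Module.finrank ℚ M)) (Fin 1 × Fin (Module.finrank ℚ M)) ℚ).map ι𝔸) 0 0
        (((Γ⁻¹ : GL (Fin 3 × Fin (Module.finrank ℚ M)) ℚ) :
          Matrix (Fin 3 × Fin (Module.finrank ℚ M)) (Fin 3 × Fin (Module.finrank ℚ M)) ℚ).map ι𝔸)).submatrix eI id := by
      rw [hγN', ← Matrix.submatrix_map, Matrix.fromBlocks_map, Matrix.map_zero ι𝔸 (map_zero ι𝔸),
        Matrix.map_zero ι𝔸 (map_zero ι𝔸)]
    rw [hX, h1, h2, ← Matrix.submatrix_mul _ _ _ _ _ eI.bijective, ← Matrix.submatrix_mul _ _ _ _ _ eI.bijective,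
      Matrix.submatrix_id_id, fromBlocks_diag_mul_diag, fromBlocks_diag_mul_diag]
  -- the framed carrier as a matrix
  have hcoe : ∀ p : ↥(finAdelic (↥(maximalRealSubfield L)) L (IsCMField.complexConj L) 3 H) × ↥(torusFinAdelic M),
      ((auxToGspFin F p : ↥(gspFinAdelic δ)) : GL (Fin g ⊕ Fin g) finAdeleQ).val =
        T.map (Int.cast : ℤ → finAdeleQ) *
          (γN.map ι𝔸 * ((auxResFin M j H p : GL ((Fin 1 ⊕ Fin 3) × Fin (Module.finrank ℚ M)) finAdeleQ) :
            Matrix ((Fin 1 ⊕ Fin 3) × Fin (Module.finrank ℚ M)) ((Fin 1 ⊕ Fin 3) × Fin (Module.finrank ℚ M)) finAdeleQ) *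
            γN'.map ι𝔸) * T'.map (Int.cast : ℤ → finAdeleQ) := by
    intro p
    rw [coe_auxToGspFin_eq_conjRect, coe_conjRect, hPA, hQA]
    simp only [Matrix.mul_assoc]
  -- membership in `K̃(N)` is read on the two blocks
  have hmem : ∀ (N : ℕ) (p : ↥(finAdelic (↥(maximalRealSubfield L)) L (IsCMField.complexConj L) 3 H) × ↥(torusFinAdelic M)),
      p ∈ auxLevel F N ↔
        (IsCongOne N
            ((Γ₀ : Matrix (Fin 1 × Fin (Module.finrank ℚ M)) (Fin 1 × Fin (Module.finrank ℚ M)) ℚ).map ι𝔸 *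
              ((auxResW₀ M p.2 : GL (Fin 1 × Fin (Module.finrank ℚ M)) finAdeleQ) :
                Matrix (Fin 1 × Fin (Module.finrank ℚ M)) (Fin 1 × Fin (Module.finrank ℚ M)) finAdeleQ) *
              ((Γ₀⁻¹ : GL (Fin 1 × Fin (Module.finrank ℚ M)) ℚ) :
                Matrix (Fin 1 × Fin (Module.finrank ℚ M)) (Fin 1 × Fin (Module.finrank ℚ M)) ℚ).map ι𝔸) ∧
          IsCongOne N
            ((Γ : Matrix (Fin 3 × Fin (Module.finrank ℚ M)) (Fin 3 × Fin (Module.finrank ℚ M)) ℚ).map ι𝔸 *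
              ((auxResV M j H p : GL (Fin 3 × Fin (Module.finrank ℚ M)) finAdeleQ) :
                Matrix (Fin 3 × Fin (Module.finrank ℚ M)) (Fin 3 × Fin (Module.finrank ℚ M)) finAdeleQ) *
              ((Γ⁻¹ : GL (Fin 3 × Fin (Module.finrank ℚ M)) ℚ) :
                Matrix (Fin 3 × Fin (Module.finrank ℚ M)) (Fin 3 × Fin (Module.finrank ℚ M)) ℚ).map ι𝔸)) ∧
        (IsCongOne N
            ((Γ₀ : Matrix (Fin 1 × Fin (Module.finrank ℚ M)) (Fin 1 × Fin (Module.finrank ℚ M)) ℚ).map ι𝔸 *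
              ((auxResW₀ M p⁻¹.2 : GL (Fin 1 × Fin (Module.finrank ℚ M)) finAdeleQ) :
                Matrix (Fin 1 × Fin (Module.finrank ℚ M)) (Fin 1 × Fin (Module.finrank ℚ M)) finAdeleQ) *
              ((Γ₀⁻¹ : GL (Fin 1 × Fin (Module.finrank ℚ M)) ℚ) :
                Matrix (Fin 1 × Fin (Module.finrank ℚ M)) (Fin 1 × Fin (Module.finrank ℚ M)) ℚ).map ι𝔸) ∧
          IsCongOne N
            ((Γ : Matrix (Fin 3 × Fin (Module.finrank ℚ M)) (Fin 3 × Fin (Module.finrank ℚ M)) ℚ).map ι𝔸 *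
              ((auxResV M j H p⁻¹ : GL (Fin 3 × Fin (Module.finrank ℚ M)) finAdeleQ) :
                Matrix (Fin 3 × Fin (Module.finrank ℚ M)) (Fin 3 × Fin (Module.finrank ℚ M)) finAdeleQ) *
              ((Γ⁻¹ : GL (Fin 3 × Fin (Module.finrank ℚ M)) ℚ) :
                Matrix (Fin 3 × Fin (Module.finrank ℚ M)) (Fin 3 × Fin (Module.finrank ℚ M)) ℚ).map ι𝔸)) := by
    intro N p
    rw [mem_auxLevel_iff, mem_principalLevelSubgroup_iff, ← Subgroup.coe_inv, ← map_inv, hcoe, hcoe, isCongOne_intConjRect_iff _ T T' hTT' hT'T, isCongOne_intConjRect_iff _ T T' hTT' hT'T, hZ, hZ,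
      isCongOne_fromBlocks_iff, isCongOne_fromBlocks_iff]
  refine ⟨?_, fun N => ?_⟩
  · -- `K × L₀ ≤ K̃(1)`: both blocks integral
    rintro p hp
    have hp' : p⁻¹ ∈ K.prod L₀ := Subgroup.inv_mem _ hp
    rw [hmem]
    exact ⟨⟨isCongOne_one_of_forall_mem_integral (hW _ (Subgroup.mem_prod.1 hp).2),
        isCongOne_one_of_forall_mem_integral (hV _ hp)⟩,
      ⟨isCongOne_one_of_forall_mem_integral (hW _ (Subgroup.mem_prod.1 hp').2),
        isCongOne_one_of_forall_mem_integral (hV _ hp')⟩⟩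
  · -- product decomposition: the `W₀`-congruence of `(k, t)` transfers to the `V`-block of `(1, t)`
    refine subgroup_eq_prod_comap_of_one_mk_mem _ fun k t hkt => ?_
    rw [hmem] at hkt ⊢
    obtain ⟨⟨hw, -⟩, ⟨hw', -⟩⟩ := hkt
    rw [Prod.inv_mk] at hw'
    rw [Prod.inv_mk, inv_one]
    exact ⟨⟨hw, htr N t hw⟩, ⟨hw', htr N t⁻¹ hw'⟩⟩

end Literature.AlgebraicGeometry.ShimuraVarieties.UnitaryCanonicalModel.Aux

end
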